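import Literature.Geometry.Riemannian.AHChartNormalization
import Literature.Geometry.Riemannian.AHConvexNearInfinity
import Mathlib.Geometry.Manifold.MFDeriv.Atlas
import HarnessLib

/-!
# The asymptotically hyperbolic normalisation off the boundary (manifold layer)

Support file (everything proved, no definitions, no named facts) for the comparison
`|dist_g(p, ·) + log (ρ ∘ j)| ≤ C` between the distance function of a conformally compact,
boundary-normalised filling and its boundary defining function (Li–Qing–Shi 2017, p. 11:
"`u = r − t` is bounded"; an input of the proof of
`Literature.Geometry.Riemannian.liQingShi_pinching_five`, Thm. 1.8 there), in the setting of
the package `Literature.Geometry.Riemannian.IsConformallyCompactFillingOfDim`: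
`j : N → X` a smooth embedding of the bulk onto the interior of the compact manifold with
boundary `X`, `ρ ≥ 0` smooth on `X` vanishing exactly on `∂X`, `ḡ` a `C^{n'}` (`n' ≥ 1`)
Riemannian metric on `X` with `j^* ḡ = (ρ ∘ j)² g` and `|dρ|_ḡ = 1` ON `∂X` (at every boundary
point the `ḡ`-gradient of `ρ` is a unit vector). The normalisation propagates off the boundary:

* `mfderiv_symmL_eq_fderivWithin` — the differential of a function at any point of a chart
  domain, evaluated on the vector with chart coordinates `a`, is the derivative of the chart
  reading within `range I` (boundary points allowed).
* `normalization_near_point` — near each boundary point `z` there are an open `V ∋ z` and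
  `C ≥ 0` with, for every bulk point `x` with `j x ∈ V` and `u = ρ (j x)`:
  (i) `(d(ρ ∘ j)_x v)² ≤ (1 + C u) u² g(v, v)` for all `v` — i.e. `|du|_g ≤ (1 + O(u)) u`,
  `|dρ|_ḡ ≤ 1 + O(ρ)`; (ii) there is a `g`-unit `v` with `d(ρ ∘ j)_x v ≥ (1 − C u) u` — i.e.
  `|dρ|_ḡ ≥ 1 − O(ρ)`. Proof: read `ρ` and `ḡ` in the chart at `z` and apply the half-space
  calculus `ConformallyCompact.exists_normalization_constants` (`AHChartNormalization.lean`); the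
  tangent vectors of `N` are produced through `ψ = j⁻¹ ∘ φ⁻¹` on the interior of the chart
  target, as in `SimpleAH.convexity_near_point`.
* `exists_normalization_off_boundary` — **global form** on a compact `X`: there are `κ > 0` and
  `C ≥ 0` such that (i) and (ii) hold at every bulk point with `ρ (j x) < κ` (finitely many
  charts cover `∂X`, `SimpleAH.exists_sublevel_subset`).

## References

* G. Li, J. Qing, Y. Shi, *Gap phenomena and curvature estimates for conformally compact
  Einstein manifolds*, Trans. AMS 369 (2017), Def. 2.1 (p. 6), p. 11. [LiQingShi2017]
* C. R. Graham, C. Guillarmou, P. Stefanov, G. Uhlmann, Ann. Inst. Fourier 69 (2019), §2.1.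
  [GrahamEtAl2020]
-/

noncomputable section

open Bundle Set Filter Function Metric TopologicalSpace
open scoped Manifold ContDiff Topology

namespace Literature.Geometry.Riemannian

namespace ConformallyCompact

open Literature.Geometry.Lorentzian
open Literature.Geometry.Lorentzian.PseudoRiemannianMetric
open SimpleAH

set_option maxSynthPendingDepth 3

/-! ### Reading a differential in a non-preferred chart -/

section ChartReading

variable {E : Type*} [NormedAddCommGroup E] [NormedSpace ℝ E] {H' : Type*} [TopologicalSpace H']
  {I' : ModelWithCorners ℝ E H'} {X : Type*} [TopologicalSpace X] [ChartedSpace H' X]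
  [IsManifold I' ∞ X]

/-- **The differential in a non-preferred chart.** For `ρ` differentiable at a point `y` of the
chart domain of `z`, `dρ_y` evaluated on the tangent vector whose coordinates in the chart at
`z` are `a` (the inverse trivialization `symmL`) is the derivative of `ρ ∘ φ_z⁻¹` within
`range I` at `φ_z y` (chain rule within `range I`; boundary points allowed). [folklore] -/
theorem mfderiv_symmL_eq_fderivWithin {ρ : X → ℝ} {z y : X} (hy : y ∈ (chartAt H' z).source)
    (hρ : MDifferentiableAt I' 𝓘(ℝ, ℝ) ρ y) (a : E) :
    mfderiv I' 𝓘(ℝ, ℝ) ρ y ((trivializationAt E (TangentSpace I') z).symmL ℝ y a) =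
      fderivWithin ℝ (ρ ∘ (extChartAt I' z).symm) (range I') (extChartAt I' z y) a := by
  have hys : y ∈ (extChartAt I' z).source := by rwa [extChartAt_source]
  have hq : extChartAt I' z y ∈ (extChartAt I' z).target := (extChartAt I' z).map_source hys
  have hyy : (extChartAt I' z).symm (extChartAt I' z y) = y := (extChartAt I' z).left_inv hys
  have hsymm : MDifferentiableWithinAt 𝓘(ℝ, E) I' (extChartAt I' z).symm (range I')
      (extChartAt I' z y) := mdifferentiableWithinAt_extChartAt_symm hq
  have hρ' : MDifferentiableAt I' 𝓘(ℝ, ℝ) ρ ((extChartAt I' z).symm (extChartAt I' z y)) := by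
    rwa [hyy]
  have huniq : UniqueMDiffWithinAt 𝓘(ℝ, E) (range I') (extChartAt I' z y) := by
    rw [uniqueMDiffWithinAt_iff_uniqueDiffWithinAt]
    exact I'.uniqueDiffOn _ (extChartAt_target_subset_range z hq)
  have hcomp := mfderiv_comp_mfderivWithin (extChartAt I' z y) hρ' hsymm huniq
  rw [mfderivWithin_eq_fderivWithin] at hcomp
  rw [TangentBundle.symmL_trivializationAt hy, hcomp, hyy]
  rfl

end ChartReading

/-! ### The normalisation near one boundary point -/

section PerPoint

variable {n : ℕ}
  {N : Type*} [TopologicalSpace N] [ChartedSpace (EuclideanSpace ℝ (Fin (n + 1))) N]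
  [IsManifold (𝓡 (n + 1)) ∞ N]
  {X : Type*} [TopologicalSpace X] [ChartedSpace (EuclideanHalfSpace (n + 1)) X]
  [IsManifold (𝓡∂ (n + 1)) ∞ X]

set_option maxHeartbeats 1600000 in
/-- **The asymptotically hyperbolic normalisation off the boundary, near one boundary point.**
In the setting of the module docstring, let `z ∈ ∂X`. Then there are an open `V ∋ z` and `C ≥ 0`
such that for every `x : N` with `j x ∈ V`, writing `u = ρ (j x)`:
(i) `(d(ρ ∘ j)_x v)² ≤ (1 + C u) · u² · g(v, v)` for every `v`;
(ii) there is `v` with `g(v, v) = 1` and `(1 − C u) u ≤ d(ρ ∘ j)_x v`.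
[cite: LiQingShi2017, Def. 2.1 and p. 11] -/
theorem normalization_near_point {nG n' : ℕ∞ω}
    (G : PseudoRiemannianMetric (𝓡 (n + 1)) nG (EuclideanSpace ℝ (Fin (n + 1)))
      (TangentSpace (𝓡 (n + 1)) : N → Type _))
    (gb : PseudoRiemannianMetric (𝓡∂ (n + 1)) n' (EuclideanSpace ℝ (Fin (n + 1)))
      (TangentSpace (𝓡∂ (n + 1)) : X → Type _)) (hn' : 1 ≤ n') (hgb : gb.IsRiemannian)
    {j : N → X} (hj : Manifold.IsSmoothEmbedding (𝓡 (n + 1)) (𝓡∂ (n + 1)) ∞ j)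
    (hjr : range j = (𝓡∂ (n + 1)).interior X)
    {ρ : X → ℝ} (hρ : ContMDiff (𝓡∂ (n + 1)) 𝓘(ℝ, ℝ) ∞ ρ) (hρ0 : ∀ x, 0 ≤ ρ x)
    (hρb : ∀ x, ρ x = 0 ↔ x ∈ (𝓡∂ (n + 1)).boundary X)
    (hconf : ∀ (x : N) (v w : TangentSpace (𝓡 (n + 1)) x),
      gb.val (j x) (mfderiv (𝓡 (n + 1)) (𝓡∂ (n + 1)) j x v) (mfderiv (𝓡 (n + 1)) (𝓡∂ (n + 1)) j x w)
        = ρ (j x) ^ 2 * G.val x v w)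
    (hν : ∀ y ∈ (𝓡∂ (n + 1)).boundary X, ∃ ν : TangentSpace (𝓡∂ (n + 1)) y, gb.val y ν ν = 1 ∧
      ∀ a : TangentSpace (𝓡∂ (n + 1)) y, gb.val y ν a = mfderiv (𝓡∂ (n + 1)) 𝓘(ℝ, ℝ) ρ y a)
    {z : X} (hz : z ∈ (𝓡∂ (n + 1)).boundary X) :
    ∃ V : Set X, IsOpen V ∧ z ∈ V ∧ ∃ C : ℝ, 0 ≤ C ∧ ∀ x : N, j x ∈ V →
      (∀ v : TangentSpace (𝓡 (n + 1)) x,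
        (mvfderiv (𝓡 (n + 1)) (ρ ∘ j) x v) ^ 2 ≤
          (1 + C * ρ (j x)) * ρ (j x) ^ 2 * G.val x v v) ∧
      (∃ v : TangentSpace (𝓡 (n + 1)) x, G.val x v v = 1 ∧
        (1 - C * ρ (j x)) * ρ (j x) ≤ mvfderiv (𝓡 (n + 1)) (ρ ∘ j) x v) := by
  -- notation
  set I' := 𝓡∂ (n + 1) with hI'
  set φ := extChartAt (𝓡∂ (n + 1)) z with hφ
  set e := trivializationAt (EuclideanSpace ℝ (Fin (n + 1))) (TangentSpace (𝓡∂ (n + 1)) : X → Type _) z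
    with he
  set x₀ : EuclideanSpace ℝ (Fin (n + 1)) := φ z with hx₀
  set S : Set (EuclideanSpace ℝ (Fin (n + 1))) := φ.target with hS
  set rh : EuclideanSpace ℝ (Fin (n + 1)) → ℝ := fun q ↦ ρ (φ.symm q) with hrh
  set Q : EuclideanSpace ℝ (Fin (n + 1)) →
      EuclideanSpace ℝ (Fin (n + 1)) →L[ℝ] EuclideanSpace ℝ (Fin (n + 1)) →L[ℝ] ℝ :=
    fun q ↦ (ContinuousLinearMap.precomp ℝ (e.symmL ℝ (φ.symm q))).comp
      ((gb.val (φ.symm q)).comp (e.symmL ℝ (φ.symm q))) with hQ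
  have hQapp : ∀ (q a b : EuclideanSpace ℝ (Fin (n + 1))),
      Q q a b = gb.val (φ.symm q) (e.symmL ℝ (φ.symm q) a) (e.symmL ℝ (φ.symm q) b) := by
    intro q a b
    simp only [hQ, ContinuousLinearMap.comp_apply, ContinuousLinearMap.precomp_apply]
  have hx₀S : x₀ ∈ S := mem_extChartAt_target z
  have hSrange : S ⊆ range (𝓡∂ (n + 1)) := extChartAt_target_subset_range z
  have hrange : range (𝓡∂ (n + 1)) = {y : EuclideanSpace ℝ (Fin (n + 1)) | 0 ≤ y 0} :=
    range_modelWithCornersEuclideanHalfSpace (n + 1)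
  have hSr : S ⊆ {y : EuclideanSpace ℝ (Fin (n + 1)) | 0 ≤ y 0} := hrange ▸ hSrange
  have hsymm_src : ∀ q ∈ S, φ.symm q ∈ (chartAt (EuclideanHalfSpace (n + 1)) z).source := by
    intro q hq
    rw [← extChartAt_source (𝓡∂ (n + 1))]
    exact φ.map_target hq
  -- basic facts on the `symmL` of the trivialization over the chart domain
  have hsymmL_inj' : ∀ {x : X} (hx : x ∈ (chartAt (EuclideanHalfSpace (n + 1)) z).source)
      {a b : EuclideanSpace ℝ (Fin (n + 1))}, e.symmL ℝ x a = e.symmL ℝ x b → a = b := by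
    intro x hx a b hab
    have hxe : x ∈ e.baseSet := by rwa [he, TangentBundle.trivializationAt_baseSet]
    have h3 := congrArg (e.continuousLinearMapAt ℝ x) hab
    rwa [e.continuousLinearMapAt_symmL hxe, e.continuousLinearMapAt_symmL hxe] at h3
  have hsymmL_inj : ∀ {x : X} (hx : x ∈ (chartAt (EuclideanHalfSpace (n + 1)) z).source)
      {a : EuclideanSpace ℝ (Fin (n + 1))}, e.symmL ℝ x a = 0 → a = 0 := by
    intro x hx a ha
    exact hsymmL_inj' hx (by rw [ha, map_zero])
  -- smoothness in the chart
  have hr1 : ContDiffWithinAt ℝ ∞ rh (range (𝓡∂ (n + 1))) x₀ :=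
    contDiffWithinAt_comp_extChartAt_symm (hρ z)
  have hQ1 : ContDiffWithinAt ℝ n' Q (range (𝓡∂ (n + 1))) x₀ := contDiffWithinAt_metricInChart gb z
  obtain ⟨U₁, hU₁o, hxU₁, hrU⟩ := hr1.contDiffOn' (m := 2) (WithTop.coe_le_coe.2 le_top) (by simp)
  obtain ⟨U₂, hU₂o, hxU₂, hQU⟩ := hQ1.contDiffOn' (m := 1) hn' (by simp)
  rw [insert_eq_of_mem (hSrange hx₀S)] at hrU hQU
  set U := U₁ ∩ U₂ with hU
  have hUo : IsOpen U := hU₁o.inter hU₂o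
  have hxU : x₀ ∈ U := ⟨hxU₁, hxU₂⟩
  have hrSU : ContDiffOn ℝ 2 rh (S ∩ U) :=
    hrU.mono (inter_subset_inter hSrange inter_subset_left)
  have hQSU : ContDiffOn ℝ 1 Q (S ∩ U) :=
    hQU.mono (inter_subset_inter hSrange inter_subset_right)
  -- `rh` is smooth on the whole chart target
  have hrhS : ContDiffOn ℝ ∞ rh S :=
    (hρ.comp_contMDiffOn (contMDiffOn_extChartAt_symm (I := 𝓡∂ (n + 1)) z)).contDiffOn
  -- positivity and symmetry of `Q` on the chart target
  have hQpos : ∀ q ∈ S ∩ U, ∀ a : EuclideanSpace ℝ (Fin (n + 1)), a ≠ 0 → 0 < Q q a a := by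
    intro q hq a ha
    rw [hQapp]
    exact hgb _ _ fun h0 ↦ ha (hsymmL_inj (hsymm_src q hq.1) h0)
  have hQsymm : ∀ q ∈ S ∩ U, ∀ a b : EuclideanSpace ℝ (Fin (n + 1)), Q q a b = Q q b a := by
    intro q _ a b
    rw [hQapp, hQapp, gb.symm]
  have hr0' : ∀ q ∈ S ∩ U, 0 ≤ rh q := fun q _ ↦ hρ0 _
  -- interior points of the chart target are the points with positive first coordinate
  have hintS : ∀ q ∈ S, 0 < q 0 → q ∈ interior S := by
    intro q hq hq0
    have hct : IsOpen ((𝓡∂ (n + 1)).symm ⁻¹' (chartAt (EuclideanHalfSpace (n + 1)) z).target) :=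
      (𝓡∂ (n + 1)).continuous_symm.isOpen_preimage _ (chartAt _ z).open_target
    have hpos : IsOpen {y : EuclideanSpace ℝ (Fin (n + 1)) | 0 < y 0} :=
      isOpen_lt continuous_const (continuous_apply_coord 0)
    have hq' : q ∈ (𝓡∂ (n + 1)).symm ⁻¹' (chartAt (EuclideanHalfSpace (n + 1)) z).target ∩
        range (𝓡∂ (n + 1)) := by rwa [hS, hφ, extChartAt_target] at hq
    refine mem_interior.2 ⟨_, fun y hy ↦ ?_, hct.inter hpos, ⟨hq'.1, hq0⟩⟩
    rw [hS, hφ, extChartAt_target]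
    exact ⟨hy.1, by rw [hrange]; exact (show (0 : ℝ) < y 0 from hy.2).le⟩
  have hSint : interior S ⊆ {y : EuclideanSpace ℝ (Fin (n + 1)) | 0 < y 0} := by
    rw [← interior_range_modelWithCornersEuclideanHalfSpace (n + 1)]
    exact interior_mono hSrange
  -- the chart centre lies on the boundary hyperplane
  have hx₀0 : x₀ 0 = 0 := by
    by_contra h0
    have hpos : 0 < x₀ 0 := lt_of_le_of_ne (hSr hx₀S) (Ne.symm h0)
    have hint : (𝓡∂ (n + 1)).IsInteriorPoint z :=
      (isInteriorPoint_iff_extChartAt (mem_chart_source _ z)).2 (hintS x₀ hx₀S hpos)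
    exact Set.disjoint_left.1 (ModelWithCorners.disjoint_interior_boundary (I := 𝓡∂ (n + 1)))
      hint hz
  -- derivatives within `S` and within `range I` agree on `S`
  have hSderiv : ∀ q ∈ S, fderivWithin ℝ rh S q = fderivWithin ℝ rh (range (𝓡∂ (n + 1))) q := by
    intro q hq
    refine (fderivWithin_of_mem_nhdsWithin (extChartAt_target_mem_nhdsWithin_of_mem hq)
      ((𝓡∂ (n + 1)).uniqueDiffOn _ (hSrange hq)) ?_).symm
    exact (hrhS q hq).differentiableWithinAt (by simp)
  -- the boundary condition in the chart
  have hbd : ∀ q ∈ S ∩ U, q 0 = 0 →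
      rh q = 0 ∧ ∃ ν : EuclideanSpace ℝ (Fin (n + 1)), Q q ν ν = 1 ∧
        ∀ a, Q q ν a = fderivWithin ℝ rh S q a := by
    intro q hq hq0
    set y : X := φ.symm q with hy
    have hysrc : y ∈ (chartAt (EuclideanHalfSpace (n + 1)) z).source := hsymm_src q hq.1
    have hφy : φ y = q := φ.right_inv hq.1
    have hybd : y ∈ (𝓡∂ (n + 1)).boundary X := by
      rw [← ModelWithCorners.compl_interior]
      intro hyint
      have h1 := (isInteriorPoint_iff_extChartAt hysrc).1 hyint
      rw [← hφ, hφy] at h1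
      have h2 := hSint h1
      simp only [mem_setOf_eq, hq0, lt_self_iff_false] at h2
    obtain ⟨ν, hν1, hν2⟩ := hν y hybd
    have hye : y ∈ e.baseSet := by rwa [he, TangentBundle.trivializationAt_baseSet]
    set νh : EuclideanSpace ℝ (Fin (n + 1)) := e.continuousLinearMapAt ℝ y ν with hνh
    have hνh' : e.symmL ℝ y νh = ν := e.symmL_continuousLinearMapAt hye ν
    have hρd : MDifferentiableAt (𝓡∂ (n + 1)) 𝓘(ℝ, ℝ) ρ y := (hρ y).mdifferentiableAt (by simp)
    refine ⟨(hρb y).2 hybd, νh, ?_, fun a ↦ ?_⟩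
    · rw [hQapp, ← hy, hνh', hν1]
    · rw [hQapp, ← hy, hνh', hν2, hSderiv q hq.1, ← hφy]
      exact mfderiv_symmL_eq_fderivWithin hysrc hρd a
  -- the half-space calculus
  have hSn : S ∈ 𝓝[{y : EuclideanSpace ℝ (Fin (n + 1)) | 0 ≤ y 0}] x₀ :=
    hrange ▸ extChartAt_target_mem_nhdsWithin z
  obtain ⟨δ, A, B, hδ, -, hB, hballSU, hest⟩ :=
    exists_normalization_constants (i₀ := (0 : Fin (n + 1))) hSr (uniqueDiffOn_extChartAt_target z)
      hx₀S hx₀0 hSn hUo hxU hrSU hr0' hQSU hQsymm hQpos hbd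
  -- the neighbourhood `V`
  set V : Set X := φ.source ∩ φ ⁻¹' ball x₀ δ with hV
  have hVo : IsOpen V := isOpen_extChartAt_preimage' z isOpen_ball
  have hzV : z ∈ V := ⟨mem_extChartAt_source z, mem_ball_self hδ⟩
  refine ⟨V, hVo, hzV, B, hB, fun x hxV ↦ ?_⟩
  haveI : Nonempty N := ⟨x⟩
  -- the open set `O = interior S` of the model space and the map `ψ = j⁻¹ ∘ φ⁻¹ : O → N`
  set O : Opens (EuclideanSpace ℝ (Fin (n + 1))) := ⟨interior S, isOpen_interior⟩ with hO
  have hOS : ∀ p : O, (p : EuclideanSpace ℝ (Fin (n + 1))) ∈ S := fun p ↦ interior_subset p.2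
  have hOint : ∀ p : O, φ.symm p ∈ (𝓡∂ (n + 1)).interior X := by
    intro p
    have hsrc := hsymm_src p (hOS p)
    show (𝓡∂ (n + 1)).IsInteriorPoint (φ.symm p)
    rw [isInteriorPoint_iff_extChartAt hsrc, ← hφ, φ.right_inv (hOS p)]
    exact p.2
  have hOrange : ∀ p : O, φ.symm p ∈ range j := fun p ↦ by rw [hjr]; exact hOint p
  set ψ : O → N := fun p ↦ Function.invFun j (φ.symm p) with hψ
  have hjψ : ∀ p : O, j (ψ p) = φ.symm p := fun p ↦ Function.invFun_eq (hOrange p)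
  have hjψ' : (fun p : O ↦ j (ψ p)) = fun p : O ↦ φ.symm p := funext hjψ
  have hΦs : ContMDiff 𝓘(ℝ, EuclideanSpace ℝ (Fin (n + 1))) (𝓡∂ (n + 1)) ∞
      (fun p : O ↦ φ.symm (p : EuclideanSpace ℝ (Fin (n + 1)))) :=
    (contMDiffOn_extChartAt_symm z).comp_contMDiff contMDiff_subtype_val fun p ↦ hOS p
  have hje : Topology.IsEmbedding j := hj.isEmbedding
  have hψc : Continuous ψ := by
    rw [hje.isInducing.continuous_iff, Function.comp_def, hjψ']
    exact hΦs.continuous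
  have hψs : ContMDiff 𝓘(ℝ, EuclideanSpace ℝ (Fin (n + 1))) (𝓡 (n + 1)) ∞ ψ := by
    intro p
    refine (ContMDiffAt.iff_comp_isImmersionAt (hj.isImmersion.isImmersionAt (ψ p))).2
      ⟨hψc.continuousAt, ?_⟩
    rw [Function.comp_def, hjψ']
    exact hΦs p
  -- differentials: `dj (dψ a) = τ⁻¹ a`
  have hφsymm_d : ∀ p : O, MDifferentiableAt 𝓘(ℝ, EuclideanSpace ℝ (Fin (n + 1))) (𝓡∂ (n + 1))
      φ.symm p := by
    intro p
    have hSn' : S ∈ 𝓝 (p : EuclideanSpace ℝ (Fin (n + 1))) := mem_interior_iff_mem_nhds.1 p.2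
    exact ((contMDiffOn_extChartAt_symm (n := ∞) z _ (hOS p)).contMDiffAt hSn').mdifferentiableAt
      (by simp)
  have hdΦ : ∀ (p : O) (a : EuclideanSpace ℝ (Fin (n + 1))),
      mfderiv 𝓘(ℝ, EuclideanSpace ℝ (Fin (n + 1))) (𝓡∂ (n + 1))
        (fun p : O ↦ φ.symm (p : EuclideanSpace ℝ (Fin (n + 1)))) p a =
      e.symmL ℝ (φ.symm p) a := by
    intro p a
    have hval : MDifferentiableAt 𝓘(ℝ, EuclideanSpace ℝ (Fin (n + 1)))
        𝓘(ℝ, EuclideanSpace ℝ (Fin (n + 1))) (Subtype.val : O → _) p :=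
      (contMDiff_subtype_val (n := ∞) p).mdifferentiableAt (by simp)
    have hcomp := mfderiv_comp p (hφsymm_d p) hval
    have : (fun p : O ↦ φ.symm (p : EuclideanSpace ℝ (Fin (n + 1)))) = φ.symm ∘ Subtype.val := rfl
    rw [this, hcomp, ContinuousLinearMap.comp_apply, mfderiv_subtype_val_apply,
      mfderiv_extChartAt_symm_apply_eq_symmL p.2]
  have hjd : ∀ x, MDifferentiableAt (𝓡 (n + 1)) (𝓡∂ (n + 1)) j x :=
    fun x ↦ (hj.contMDiff x).mdifferentiableAt (by simp)
  have hψd : ∀ p, MDifferentiableAt 𝓘(ℝ, EuclideanSpace ℝ (Fin (n + 1))) (𝓡 (n + 1)) ψ p :=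
    fun p ↦ (hψs p).mdifferentiableAt (by simp)
  have hdψ : ∀ (p : O) (a : EuclideanSpace ℝ (Fin (n + 1))),
      mfderiv (𝓡 (n + 1)) (𝓡∂ (n + 1)) j (ψ p)
        (mfderiv 𝓘(ℝ, EuclideanSpace ℝ (Fin (n + 1))) (𝓡 (n + 1)) ψ p a) = e.symmL ℝ (φ.symm p) a := by
    intro p a
    have hcomp := mfderiv_comp p (hjd (ψ p)) (hψd p)
    have h1 : mfderiv 𝓘(ℝ, EuclideanSpace ℝ (Fin (n + 1))) (𝓡∂ (n + 1)) (j ∘ ψ) p a =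
        mfderiv (𝓡 (n + 1)) (𝓡∂ (n + 1)) j (ψ p) (mfderiv 𝓘(ℝ, _) (𝓡 (n + 1)) ψ p a) := by
      rw [hcomp]; rfl
    rw [← h1, Function.comp_def, hjψ', hdΦ]
  -- the point `p₁ = φ (j x) ∈ O`
  set y : X := j x with hyx
  have hysrc : y ∈ φ.source := hxV.1
  have hysrc' : y ∈ (chartAt (EuclideanHalfSpace (n + 1)) z).source := by
    rwa [← extChartAt_source (𝓡∂ (n + 1))]
  have hyint : (𝓡∂ (n + 1)).IsInteriorPoint y := by
    show y ∈ (𝓡∂ (n + 1)).interior X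
    rw [← hjr]
    exact mem_range_self _
  have hphat : φ y ∈ interior S := (isInteriorPoint_iff_extChartAt hysrc').1 hyint
  set p₁ : O := ⟨φ y, hphat⟩ with hp₁
  have hp₁S : (p₁ : EuclideanSpace ℝ (Fin (n + 1))) ∈ S := hOS p₁
  have hsymm_p₁ : φ.symm (p₁ : EuclideanSpace ℝ (Fin (n + 1))) = y := φ.left_inv hysrc
  have hψp₁ : ψ p₁ = x := hje.injective (by rw [hjψ, hsymm_p₁])
  -- the estimates of the half-space calculus at `p₁`
  have hp₁half : (p₁ : EuclideanSpace ℝ (Fin (n + 1))) ∈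
      {y : EuclideanSpace ℝ (Fin (n + 1)) | 0 ≤ y 0} ∩ ball x₀ δ := ⟨hSr hp₁S, hxV.2⟩
  obtain ⟨-, hb_, hc_⟩ := hest _ hp₁half
  have hrhp : rh p₁ = ρ y := by rw [hrh]; exact congrArg ρ hsymm_p₁
  -- differentials at `x` read in the chart
  have hρd : MDifferentiableAt (𝓡∂ (n + 1)) 𝓘(ℝ, ℝ) ρ y := (hρ y).mdifferentiableAt (by simp)
  have hdcomp : ∀ v : TangentSpace (𝓡 (n + 1)) x, mvfderiv (𝓡 (n + 1)) (ρ ∘ j) x v =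
      mfderiv (𝓡∂ (n + 1)) 𝓘(ℝ, ℝ) ρ y (mfderiv (𝓡 (n + 1)) (𝓡∂ (n + 1)) j x v) := by
    intro v
    show mfderiv (𝓡 (n + 1)) 𝓘(ℝ, ℝ) (ρ ∘ j) x v = _
    rw [mfderiv_comp x hρd (hjd x)]
    rfl
  have hread : ∀ a : EuclideanSpace ℝ (Fin (n + 1)),
      mfderiv (𝓡∂ (n + 1)) 𝓘(ℝ, ℝ) ρ y (e.symmL ℝ y a) = fderivWithin ℝ rh S p₁ a := by
    intro a
    rw [hSderiv _ hp₁S]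
    exact mfderiv_symmL_eq_fderivWithin hysrc' hρd a
  -- every tangent vector at `x` has chart coordinates
  have hcoord : ∀ v : TangentSpace (𝓡 (n + 1)) x, ∃ a : EuclideanSpace ℝ (Fin (n + 1)),
      mfderiv (𝓡 (n + 1)) (𝓡∂ (n + 1)) j x v = e.symmL ℝ y a := by
    intro v
    have hye : y ∈ e.baseSet := by rwa [he, TangentBundle.trivializationAt_baseSet]
    exact ⟨e.continuousLinearMapAt ℝ y (mfderiv (𝓡 (n + 1)) (𝓡∂ (n + 1)) j x v),
      (e.symmL_continuousLinearMapAt hye _).symm⟩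
  have hQy : ∀ a b : EuclideanSpace ℝ (Fin (n + 1)),
      Q p₁ a b = gb.val y (e.symmL ℝ y a) (e.symmL ℝ y b) := by
    intro a b
    rw [hQapp, hsymm_p₁]
  refine ⟨fun v ↦ ?_, ?_⟩
  · -- (i) the upper bound
    obtain ⟨a, ha⟩ := hcoord v
    have hc := hconf x v v
    rw [← hyx, ha, ← hQy] at hc
    -- `hc : Q p₁ a a = ρ y ^ 2 * G x v v`
    have h1 := hb_ a
    rw [← hread a, ← ha, ← hdcomp v, hrhp, hc] at h1
    calc (mvfderiv (𝓡 (n + 1)) (ρ ∘ j) x v) ^ 2 ≤ (1 + B * ρ y) * (ρ y ^ 2 * G.val x v v) := h1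
      _ = (1 + B * ρ (j x)) * ρ (j x) ^ 2 * G.val x v v := by rw [hyx]; ring
  · -- (ii) the almost-unit normal
    obtain ⟨a, ha1, ha2⟩ := hc_
    set v : TangentSpace (𝓡 (n + 1)) x :=
      mfderiv 𝓘(ℝ, EuclideanSpace ℝ (Fin (n + 1))) (𝓡 (n + 1)) ψ p₁ a with hv
    have hjv : mfderiv (𝓡 (n + 1)) (𝓡∂ (n + 1)) j x v = e.symmL ℝ y a := by
      have h := hdψ p₁ a
      rw [hψp₁, hsymm_p₁] at h
      exact h
    have hc := hconf x v v
    rw [← hyx, hjv, ← hQy, ha1] at hc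
    -- `hc : 1 = ρ y ^ 2 * G x v v`
    have hρy : 0 < ρ y := by
      have hnb : y ∉ (𝓡∂ (n + 1)).boundary X := fun hb ↦
        Set.disjoint_left.1 ModelWithCorners.disjoint_interior_boundary hyint hb
      exact lt_of_le_of_ne (hρ0 _) fun h0 ↦ hnb ((hρb _).1 h0.symm)
    refine ⟨ρ y • v, ?_, ?_⟩
    · simp only [map_smul, smul_apply, smul_eq_mul]
      rw [← mul_assoc, ← sq, ← hc]
    · rw [hrhp] at ha2
      have h3 : mvfderiv (𝓡 (n + 1)) (ρ ∘ j) x (ρ y • v) = ρ y * fderivWithin ℝ rh S p₁ a := by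
        rw [map_smul, smul_eq_mul, hdcomp, hjv, hread a]
      rw [h3]
      calc (1 - B * ρ y) * ρ y = ρ y * (1 - B * ρ y) := mul_comm _ _
        _ ≤ ρ y * fderivWithin ℝ rh S p₁ a := mul_le_mul_of_nonneg_left ha2 hρy.le

end PerPoint

/-! ### Globalization: a uniform collar by compactness of the boundary -/

section Global

variable {n : ℕ}
  {N : Type*} [TopologicalSpace N] [ChartedSpace (EuclideanSpace ℝ (Fin (n + 1))) N]
  [IsManifold (𝓡 (n + 1)) ∞ N]
  {X : Type*} [TopologicalSpace X] [ChartedSpace (EuclideanHalfSpace (n + 1)) X]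
  [IsManifold (𝓡∂ (n + 1)) ∞ X] [CompactSpace X]

/-- **The asymptotically hyperbolic normalisation off the boundary** (global form). In the
setting of the module docstring (compact `X`, boundary `ι(B) = ∂X` carrying the unit normals of
conjunct (8) of the filling package), there are `κ > 0` and `C ≥ 0` such that at every bulk
point `x` with `u = ρ (j x) < κ`: (i) `(d(ρ ∘ j)_x v)² ≤ (1 + C u) u² g(v, v)` for all `v`
(`|dρ|²_ḡ ≤ 1 + O(ρ)`), and (ii) some `g`-unit `v` has `d(ρ ∘ j)_x v ≥ (1 − C u) u`
(`|dρ|_ḡ ≥ 1 − O(ρ)`). [cite: LiQingShi2017, Def. 2.1 and p. 11] -/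
theorem exists_normalization_off_boundary {nG n' : ℕ∞ω}
    (G : PseudoRiemannianMetric (𝓡 (n + 1)) nG (EuclideanSpace ℝ (Fin (n + 1)))
      (TangentSpace (𝓡 (n + 1)) : N → Type _))
    (gb : PseudoRiemannianMetric (𝓡∂ (n + 1)) n' (EuclideanSpace ℝ (Fin (n + 1)))
      (TangentSpace (𝓡∂ (n + 1)) : X → Type _)) (hn' : 1 ≤ n') (hgb : gb.IsRiemannian)
    {j : N → X} (hj : Manifold.IsSmoothEmbedding (𝓡 (n + 1)) (𝓡∂ (n + 1)) ∞ j)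
    (hjr : range j = (𝓡∂ (n + 1)).interior X)
    {ρ : X → ℝ} (hρ : ContMDiff (𝓡∂ (n + 1)) 𝓘(ℝ, ℝ) ∞ ρ) (hρ0 : ∀ x, 0 ≤ ρ x)
    (hρb : ∀ x, ρ x = 0 ↔ x ∈ (𝓡∂ (n + 1)).boundary X)
    (hconf : ∀ (x : N) (v w : TangentSpace (𝓡 (n + 1)) x),
      gb.val (j x) (mfderiv (𝓡 (n + 1)) (𝓡∂ (n + 1)) j x v) (mfderiv (𝓡 (n + 1)) (𝓡∂ (n + 1)) j x w)
        = ρ (j x) ^ 2 * G.val x v w)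
    {B : Type*} (ι : B → X) (hιr : range ι = (𝓡∂ (n + 1)).boundary X)
    (hν : ∀ y : B, ∃ ν : TangentSpace (𝓡∂ (n + 1)) (ι y), gb.val (ι y) ν ν = 1 ∧
      ∀ a : TangentSpace (𝓡∂ (n + 1)) (ι y), gb.val (ι y) ν a = mfderiv (𝓡∂ (n + 1)) 𝓘(ℝ, ℝ) ρ (ι y) a) :
    ∃ κ C : ℝ, 0 < κ ∧ 0 ≤ C ∧ ∀ x : N, ρ (j x) < κ →
      (∀ v : TangentSpace (𝓡 (n + 1)) x,
        (mvfderiv (𝓡 (n + 1)) (ρ ∘ j) x v) ^ 2 ≤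
          (1 + C * ρ (j x)) * ρ (j x) ^ 2 * G.val x v v) ∧
      (∃ v : TangentSpace (𝓡 (n + 1)) x, G.val x v v = 1 ∧
        (1 - C * ρ (j x)) * ρ (j x) ≤ mvfderiv (𝓡 (n + 1)) (ρ ∘ j) x v) := by
  classical
  set I' := 𝓡∂ (n + 1) with hI'
  have hν' : ∀ y ∈ I'.boundary X, ∃ ν : TangentSpace (𝓡∂ (n + 1)) y, gb.val y ν ν = 1 ∧
      ∀ a : TangentSpace (𝓡∂ (n + 1)) y, gb.val y ν a = mfderiv (𝓡∂ (n + 1)) 𝓘(ℝ, ℝ) ρ y a := by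
    intro y hy
    rw [← hιr] at hy
    obtain ⟨b, rfl⟩ := hy
    exact hν b
  -- the local statement at every boundary point
  have key : ∀ b : X, b ∈ I'.boundary X → ∃ (V : Set X) (C : ℝ), IsOpen V ∧ b ∈ V ∧ 0 ≤ C ∧
      ∀ x : N, j x ∈ V →
        (∀ v : TangentSpace (𝓡 (n + 1)) x,
          (mvfderiv (𝓡 (n + 1)) (ρ ∘ j) x v) ^ 2 ≤
            (1 + C * ρ (j x)) * ρ (j x) ^ 2 * G.val x v v) ∧
        (∃ v : TangentSpace (𝓡 (n + 1)) x, G.val x v v = 1 ∧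
          (1 - C * ρ (j x)) * ρ (j x) ≤ mvfderiv (𝓡 (n + 1)) (ρ ∘ j) x v) := by
    intro b hb
    obtain ⟨V, hVo, hbV, C, hC, hP⟩ :=
      normalization_near_point G gb hn' hgb hj hjr hρ hρ0 hρb hconf hν' hb
    exact ⟨V, C, hVo, hbV, hC, hP⟩
  choose! V C hVo hbV hC hP using key
  -- a finite subcover of the compact boundary
  have hbc : IsCompact (I'.boundary X) :=
    (ModelWithCorners.isClosed_boundary (I := I') (M := X) (n := ∞) (by simp)).isCompact
  obtain ⟨T, hTb, hcover⟩ := hbc.elim_nhds_subcover V fun b hb ↦ (hVo b hb).mem_nhds (hbV b hb)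
  set W : Set X := ⋃ b ∈ T, V b with hW
  have hWo : IsOpen W := isOpen_biUnion fun b hb ↦ hVo b (hTb b hb)
  -- `{ρ < ε₁} ⊆ W`
  obtain ⟨ε₁, hε₁, hε₁W⟩ := exists_sublevel_subset hρ.continuous hρ0
    (fun x hx ↦ (hρb x).1 hx) hWo hcover
  -- the constant: the sum of the local constants
  set Cs : ℝ := ∑ b ∈ T, C b with hCs
  have hCs0 : 0 ≤ Cs := Finset.sum_nonneg fun b hb ↦ hC b (hTb b hb)
  have hCle : ∀ b ∈ T, C b ≤ Cs := fun b hb ↦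
    Finset.single_le_sum (fun b' hb' ↦ hC b' (hTb b' hb')) hb
  refine ⟨ε₁, Cs, hε₁, hCs0, fun x hlt ↦ ?_⟩
  have hxW : j x ∈ W := hε₁W _ hlt
  rw [hW, mem_iUnion₂] at hxW
  obtain ⟨b, hbT, hxV⟩ := hxW
  obtain ⟨h1, v, hv1, hv2⟩ := hP b (hTb b hbT) x hxV
  have hρx : 0 ≤ ρ (j x) := hρ0 _
  have hCb : C b ≤ Cs := hCle b hbT
  refine ⟨fun w ↦ ?_, v, hv1, ?_⟩
  · -- `G(w, w) ≥ 0` from the conformal identity and positivity of `gb`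
    have hGw : 0 ≤ ρ (j x) ^ 2 * G.val x w w := by
      rw [← hconf x w w]
      by_cases hw0 : mfderiv (𝓡 (n + 1)) (𝓡∂ (n + 1)) j x w = 0
      · rw [hw0]; simp
      · exact (hgb _ _ hw0).le
    calc (mvfderiv (𝓡 (n + 1)) (ρ ∘ j) x w) ^ 2
        ≤ (1 + C b * ρ (j x)) * ρ (j x) ^ 2 * G.val x w w := h1 w
      _ ≤ (1 + Cs * ρ (j x)) * ρ (j x) ^ 2 * G.val x w w := by
          rw [mul_assoc, mul_assoc]
          gcongr
  · calc (1 - Cs * ρ (j x)) * ρ (j x) ≤ (1 - C b * ρ (j x)) * ρ (j x) := by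
          apply mul_le_mul_of_nonneg_right _ hρx
          nlinarith only [hCb, hρx]
      _ ≤ mvfderiv (𝓡 (n + 1)) (ρ ∘ j) x v := hv2

end Global

end ConformallyCompact

end Literature.Geometry.Riemannian

end
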